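import Literature.Analysis.FluidPDE.PlanarShearedGraphBand
import Literature.Analysis.FluidPDE.PlanarStreamGluing
import HarnessLib

/-!
# The interpolated-shear graph band: a shear profile `λ(x)` and a compensated transverse coordinate

Topic `Literature/Analysis/FluidPDE`. Element kinematics of the explicit pullback calculus for the
planar transport equation, generalising `PlanarShearedGraphBand.lean` (constant shear `λ ∈ ℝ`) to a
**shear profile** `λ : ℝ → ℝ` varying along the (static) graph `y = T(x)`, at the price of replacing
the transverse offset `s = y - T(x)` in the material coordinates by a **compensated transverse
coordinate** `F(x, s)` solving the first-order equation

  `(1 + λ'(x) s) ∂ₛF - λ(x) ∂ₓF = 1`                                                    (★)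

(with `F(x, s) = s` wherever `λ' = 0`, e.g. `F(x,s) = ∫ₓ^{x+λ(x)s} dr/λ(r)`; the construction of
such an `F` is not part of this file, which takes `F` and its partials `Fₓ, Fₛ` as data and (★) as
a pointwise hypothesis). With the sheared abscissa `ξ = x + λ(x) (y - T(x))`:

* `ishPullback λ T F Ξ Ξₓ t (x, y) = (Ξ(t, ξ), F(x, y - T(x)) / Ξₓ(t, ξ))`,
* `ishStream λ T F g t (x, y) = g(t, ξ) F(x, y - T(x))`,
* `ishVelocity λ λ' T Tₓ F Fₓ Fₛ g gₓ t (x, y) = (g Fₛ + λ F gₓ, -g (Fₓ - Tₓ Fₛ) - (1 + λ' s - λ Tₓ) F gₓ)`,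
  `s = y - T(x)`, the rates `g, gₓ` read at `(t, ξ)`.

The point (folklore linear algebra, the planar-graph analogue of the area-preserving tubular
coordinates of Alberti–Crippa–Mazzucato, §7 of the reference): by (★) the Jacobian of
`(x, y) ↦ (ξ, F)` is identically `1`, hence so is that of `Ψ(t, ·) = (Ξ(t,ξ), F/Ξₓ(t,ξ))`, and
`V = -(D_zΨ)⁻¹ ∂ₜΨ` is the perpendicular gradient of `H = g(t,ξ) F` (`ishVelocity_eq_perpGrad`):
the band is moved by a divergence-free velocity and every profile `Θ_ref ∘ Ψ` is transported
(`transport_comp_ishPullback`). With `λ ≡ ± 1/2` near the two ends of a diagonal-frame corner and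
`F = s` there, BOTH arms of the corner are unsheared (`PlanarShearedGraphBand`:
`shAbscissa_normal_invariant`), which is what a width transition needs in order to be handed over
on either arm; for a constant profile and `F(x, s) = s` everything reduces to the sheared band
(`ishPullback_const`, `ishVelocity_const`, `ishStream_const`).

Folklore; no named facts. Infrastructure towards a discharge of `acm_compatible_blocks`
(`QuasiSelfSimilarCompatibleBlocks.lean`).

## References

* G. Alberti, G. Crippa, A. L. Mazzucato, *Exponential self-similar mixing by incompressible
  flows*, J. Amer. Math. Soc. 32 (2019), 445–490, §7 (area-preserving tubular coordinates
  `Φ(s,y) = γ(s) + α(s, y/ℓ) η(s)`, Lemma before §7.1) (arXiv:1605.02090).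
-/

noncomputable section

open Function Set Filter
open scoped Topology ContDiff

namespace Literature.Analysis.FluidPDE

namespace PlanarKinematics

/-- The plane `ℝ²` as a Euclidean space. [folklore] -/
local notation "E²" => EuclideanSpace ℝ (Fin 2)

variable {G : Type*} [NormedAddCommGroup G] [NormedSpace ℝ G]

/-! ## Definitions -/

/-- **Interpolated sheared abscissa** `ξ((x, y)) = x + λ(x) (y - T(x))`. [folklore] -/
def ishAbscissa (lam : ℝ → ℝ) (T : ℝ → ℝ) (w : E²) : ℝ := w 0 + lam (w 0) * (w 1 - T (w 0))

/-- **Interpolated-shear band, material coordinates**: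
`Ψ(t, (x, y)) = (Ξ(t, ξ), F(x, y - T(x)) / Ξₓ(t, ξ))`. [folklore] -/
def ishPullback (lam : ℝ → ℝ) (T : ℝ → ℝ) (F : ℝ → ℝ → ℝ) (Ξ Ξx : ℝ → ℝ → ℝ) (t : ℝ) (w : E²) : E² :=
  vec2 (Ξ t (ishAbscissa lam T w)) (F (w 0) (w 1 - T (w 0)) / Ξx t (ishAbscissa lam T w))

/-- **Interpolated-shear band, stream function**: `H(t, (x, y)) = g(t, ξ) F(x, y - T(x))`.
[folklore] -/
def ishStream (lam : ℝ → ℝ) (T : ℝ → ℝ) (F : ℝ → ℝ → ℝ) (g : ℝ → ℝ → ℝ) (t : ℝ) (w : E²) : ℝ :=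
  g t (ishAbscissa lam T w) * F (w 0) (w 1 - T (w 0))

/-- **Interpolated-shear band, velocity**:
`V = (g Fₛ + λ F gₓ, -g (Fₓ - Tₓ Fₛ) - (1 + λ' s - λ Tₓ) F gₓ)`, `s = y - T(x)`, the rates `g, gₓ`
read at `(t, ξ)`, the profile data `λ, λ', Tₓ` at `x` and `F, Fₓ, Fₛ` at `(x, s)`. [folklore] -/
def ishVelocity (lam lamx : ℝ → ℝ) (T Tx : ℝ → ℝ) (F Fu Fs : ℝ → ℝ → ℝ) (g gx : ℝ → ℝ → ℝ) (t : ℝ)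
    (w : E²) : E² :=
  vec2 (g t (ishAbscissa lam T w) * Fs (w 0) (w 1 - T (w 0)) +
      lam (w 0) * F (w 0) (w 1 - T (w 0)) * gx t (ishAbscissa lam T w))
    (-(g t (ishAbscissa lam T w) * (Fu (w 0) (w 1 - T (w 0)) - Tx (w 0) * Fs (w 0) (w 1 - T (w 0)))) -
      (1 + lamx (w 0) * (w 1 - T (w 0)) - lam (w 0) * Tx (w 0)) * F (w 0) (w 1 - T (w 0)) *
        gx t (ishAbscissa lam T w))

/-! ## Unfolding; the sheared band as the case of a constant profile and `F(x, s) = s` -/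

/-- Unfolding the abscissa. [folklore] -/
@[simp]
theorem ishAbscissa_apply (lam : ℝ → ℝ) (T : ℝ → ℝ) (w : E²) :
    ishAbscissa lam T w = w 0 + lam (w 0) * (w 1 - T (w 0)) := rfl

/-- Unfolding the pullback. [folklore] -/
@[simp]
theorem ishPullback_apply (lam : ℝ → ℝ) (T : ℝ → ℝ) (F : ℝ → ℝ → ℝ) (Ξ Ξx : ℝ → ℝ → ℝ) (t : ℝ)
    (w : E²) :
    ishPullback lam T F Ξ Ξx t w =
      vec2 (Ξ t (ishAbscissa lam T w)) (F (w 0) (w 1 - T (w 0)) / Ξx t (ishAbscissa lam T w)) := rfl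

/-- Unfolding the stream function. [folklore] -/
@[simp]
theorem ishStream_apply (lam : ℝ → ℝ) (T : ℝ → ℝ) (F : ℝ → ℝ → ℝ) (g : ℝ → ℝ → ℝ) (t : ℝ) (w : E²) :
    ishStream lam T F g t w = g t (ishAbscissa lam T w) * F (w 0) (w 1 - T (w 0)) := rfl

/-- Unfolding the velocity. [folklore] -/
@[simp]
theorem ishVelocity_apply (lam lamx : ℝ → ℝ) (T Tx : ℝ → ℝ) (F Fu Fs : ℝ → ℝ → ℝ) (g gx : ℝ → ℝ → ℝ)
    (t : ℝ) (w : E²) :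
    ishVelocity lam lamx T Tx F Fu Fs g gx t w =
      vec2 (g t (ishAbscissa lam T w) * Fs (w 0) (w 1 - T (w 0)) +
          lam (w 0) * F (w 0) (w 1 - T (w 0)) * gx t (ishAbscissa lam T w))
        (-(g t (ishAbscissa lam T w) * (Fu (w 0) (w 1 - T (w 0)) - Tx (w 0) * Fs (w 0) (w 1 - T (w 0)))) -
          (1 + lamx (w 0) * (w 1 - T (w 0)) - lam (w 0) * Tx (w 0)) * F (w 0) (w 1 - T (w 0)) *
            gx t (ishAbscissa lam T w)) := rfl

/-- A constant profile gives the sheared abscissa. [folklore] -/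
theorem ishAbscissa_const (c : ℝ) (T : ℝ → ℝ) : ishAbscissa (fun _ => c) T = shAbscissa c T := by
  funext w; rfl

/-- **A constant profile and `F(x, s) = s` give the sheared band** (pullback). [folklore] -/
theorem ishPullback_const (c : ℝ) (T : ℝ → ℝ) (Ξ Ξx : ℝ → ℝ → ℝ) :
    ishPullback (fun _ => c) T (fun _ s => s) Ξ Ξx = shGraphPullback c T Ξ Ξx := by
  funext t w; rfl

/-- **A constant profile and `F(x, s) = s` give the sheared band** (stream function). [folklore] -/
theorem ishStream_const (c : ℝ) (T : ℝ → ℝ) (g : ℝ → ℝ → ℝ) :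
    ishStream (fun _ => c) T (fun _ s => s) g = shGraphStream c g T := by
  funext t w; rfl

/-- **A constant profile and `F(x, s) = s` give the sheared band** (velocity: `λ' = 0`, `Fₓ = 0`,
`Fₛ = 1`). [folklore] -/
theorem ishVelocity_const (c : ℝ) (T Tx : ℝ → ℝ) (g gx : ℝ → ℝ → ℝ) :
    ishVelocity (fun _ => c) (fun _ => 0) T Tx (fun _ s => s) (fun _ _ => 0) (fun _ _ => 1) g gx =
      shGraphVelocity c g gx T Tx := by
  funext t w
  rw [ishVelocity_apply, shGraphVelocity_apply, ishAbscissa_const, vec2_eq_vec2_iff]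
  constructor <;> ring

/-- In a constant-slope stretch of `Ξ(t,·)` containing the abscissa (a gap of the material map,
`g = c`, `gₓ = 0` there) the velocity is the profile-free `(c Fₛ, -c (Fₓ - Tₓ Fₛ))`; where moreover
`F(x, s) = s` it is the plug flow `(c, c Tₓ)` of the graph band. [folklore] -/
theorem ishVelocity_eq_of_gap {lam lamx : ℝ → ℝ} {T Tx : ℝ → ℝ} {F Fu Fs : ℝ → ℝ → ℝ} {g gx : ℝ → ℝ → ℝ}
    {t : ℝ} {c : ℝ} {w : E²} (hg : g t (ishAbscissa lam T w) = c) (hgx : gx t (ishAbscissa lam T w) = 0) :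
    ishVelocity lam lamx T Tx F Fu Fs g gx t w =
      vec2 (c * Fs (w 0) (w 1 - T (w 0))) (-(c * (Fu (w 0) (w 1 - T (w 0)) - Tx (w 0) * Fs (w 0) (w 1 - T (w 0))))) := by
  rw [ishVelocity_apply, hg, hgx, vec2_eq_vec2_iff]
  constructor <;> ring

/-! ## Derivatives of the pullback -/

/-- **Derivative of the abscissa**: `Dξ(z)[v] = (1 + λ' s - λ Tₓ) v₀ + λ v₁`, `s = z₁ - T(z₀)`, the
profile data at `z₀`. [folklore] -/
theorem hasFDerivAt_ishAbscissa {lam lamx T Tx : ℝ → ℝ} {z : E²} (hlam : HasDerivAt lam (lamx (z 0)) (z 0))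
    (hTx : HasDerivAt T (Tx (z 0)) (z 0)) :
    HasFDerivAt (ishAbscissa lam T)
      ((1 + lamx (z 0) * (z 1 - T (z 0)) - lam (z 0) * Tx (z 0)) • (EuclideanSpace.proj (0 : Fin 2) : E² →L[ℝ] ℝ) +
        lam (z 0) • (EuclideanSpace.proj (1 : Fin 2) : E² →L[ℝ] ℝ)) z := by
  have hg : DifferentiableAt ℝ (uncurry fun a b : ℝ => a + lam a * (b - T a)) (z 0, z 1) := by
    have h2 : DifferentiableAt ℝ (fun p : ℝ × ℝ => T p.1) (z 0, z 1) :=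
      hTx.differentiableAt.comp (z 0, z 1) differentiableAt_fst
    have h3 : DifferentiableAt ℝ (fun p : ℝ × ℝ => lam p.1) (z 0, z 1) :=
      hlam.differentiableAt.comp (z 0, z 1) differentiableAt_fst
    exact differentiableAt_fst.add (h3.mul (differentiableAt_snd.sub h2))
  have h0 : HasDerivAt (fun a => a + lam a * (z 1 - T a))
      (1 + lamx (z 0) * (z 1 - T (z 0)) - lam (z 0) * Tx (z 0)) (z 0) :=
    ((hasDerivAt_id (z 0)).add (hlam.mul (hTx.const_sub (z 1)))).congr_deriv (by ring)
  have h1 : HasDerivAt (fun b => z 0 + lam (z 0) * (b - T (z 0))) (lam (z 0)) (z 1) :=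
    ((((hasDerivAt_id (z 1)).sub_const (T (z 0))).const_mul (lam (z 0))).const_add (z 0)).congr_deriv
      (by ring)
  exact hasFDerivAt_coordFun (g := fun a b : ℝ => a + lam a * (b - T a)) hg h0 h1

/-- **Derivative of the compensated transverse coordinate** `w ↦ F(w₀, w₁ - T(w₀))`:
`v ↦ (Fₓ - Tₓ Fₛ) v₀ + Fₛ v₁`, given the derivative of `F` at `(z₀, z₁ - T(z₀))`. [folklore] -/
theorem hasFDerivAt_compF {T Tx : ℝ → ℝ} {F Fu Fs : ℝ → ℝ → ℝ} {z : E²} (hTx : HasDerivAt T (Tx (z 0)) (z 0))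
    (hF : HasFDerivAt (uncurry F)
      (Fu (z 0) (z 1 - T (z 0)) • ContinuousLinearMap.fst ℝ ℝ ℝ +
        Fs (z 0) (z 1 - T (z 0)) • ContinuousLinearMap.snd ℝ ℝ ℝ) (z 0, z 1 - T (z 0))) :
    HasFDerivAt (fun w : E² => F (w 0) (w 1 - T (w 0)))
      ((Fu (z 0) (z 1 - T (z 0)) - Tx (z 0) * Fs (z 0) (z 1 - T (z 0))) •
          (EuclideanSpace.proj (0 : Fin 2) : E² →L[ℝ] ℝ) +
        Fs (z 0) (z 1 - T (z 0)) • (EuclideanSpace.proj (1 : Fin 2) : E² →L[ℝ] ℝ)) z := by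
  -- joint differentiability of `(a, b) ↦ F (a, b - T a)`
  have hφ : DifferentiableAt ℝ (fun p : ℝ × ℝ => ((p.1, p.2 - T p.1) : ℝ × ℝ)) (z 0, z 1) := by
    have h2 : DifferentiableAt ℝ (fun p : ℝ × ℝ => T p.1) (z 0, z 1) :=
      hTx.differentiableAt.comp (z 0, z 1) differentiableAt_fst
    exact differentiableAt_fst.prodMk (differentiableAt_snd.sub h2)
  have hg : DifferentiableAt ℝ (uncurry fun a b : ℝ => F a (b - T a)) (z 0, z 1) := by
    have e : (uncurry fun a b : ℝ => F a (b - T a)) = uncurry F ∘ fun p : ℝ × ℝ => ((p.1, p.2 - T p.1) : ℝ × ℝ) := by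
      funext p; rfl
    rw [e]
    exact hF.differentiableAt.comp (z 0, z 1) hφ
  -- the two partial derivatives
  have ha : HasDerivAt (fun a : ℝ => ((a, z 1 - T a) : ℝ × ℝ)) (1, -Tx (z 0)) (z 0) :=
    (hasDerivAt_id (z 0)).prodMk (hTx.const_sub (z 1))
  have h0 : HasDerivAt (fun a => F a (z 1 - T a))
      (Fu (z 0) (z 1 - T (z 0)) - Tx (z 0) * Fs (z 0) (z 1 - T (z 0))) (z 0) := by
    have h := hF.comp_hasDerivAt (z 0) ha
    refine h.congr_deriv ?_
    simp only [_root_.add_apply, _root_.smul_apply, ContinuousLinearMap.coe_fst',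
      ContinuousLinearMap.coe_snd', smul_eq_mul]
    ring
  have hb : HasDerivAt (fun b : ℝ => ((z 0, b - T (z 0)) : ℝ × ℝ)) (0, 1) (z 1) :=
    (hasDerivAt_const (z 1) (z 0)).prodMk ((hasDerivAt_id (z 1)).sub_const (T (z 0)))
  have h1 : HasDerivAt (fun b => F (z 0) (b - T (z 0))) (Fs (z 0) (z 1 - T (z 0))) (z 1) := by
    have h := hF.comp_hasDerivAt (z 1) hb
    refine h.congr_deriv ?_
    simp only [_root_.add_apply, _root_.smul_apply, ContinuousLinearMap.coe_fst',
      ContinuousLinearMap.coe_snd', smul_eq_mul]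
    ring
  exact hasFDerivAt_coordFun (g := fun a b : ℝ => F a (b - T a)) hg h0 h1

/-- **Time derivative of the pullback** (static graph and profile):
`∂ₜΨ(t,z) = (Ξₜ(t,ξ), F (-Ξₓₜ(t,ξ)/Ξₓ(t,ξ)²))`. [folklore] -/
theorem hasDerivAt_ishPullback {lam : ℝ → ℝ} {T : ℝ → ℝ} {F : ℝ → ℝ → ℝ} {Ξ Ξx Ξt Ξxt : ℝ → ℝ → ℝ} {t : ℝ}
    {z : E²} (ht : HasDerivAt (fun s => Ξ s (ishAbscissa lam T z)) (Ξt t (ishAbscissa lam T z)) t)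
    (hxt : HasDerivAt (fun s => Ξx s (ishAbscissa lam T z)) (Ξxt t (ishAbscissa lam T z)) t)
    (hne : Ξx t (ishAbscissa lam T z) ≠ 0) :
    HasDerivAt (fun s => ishPullback lam T F Ξ Ξx s z)
      (vec2 (Ξt t (ishAbscissa lam T z))
        (F (z 0) (z 1 - T (z 0)) * (-Ξxt t (ishAbscissa lam T z) / Ξx t (ishAbscissa lam T z) ^ 2))) t := by
  have hinvt : HasDerivAt (fun s => (Ξx s (ishAbscissa lam T z))⁻¹)
      (-Ξxt t (ishAbscissa lam T z) / Ξx t (ishAbscissa lam T z) ^ 2) t := hxt.fun_inv hne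
  have h := hasDerivAt_vec2 ht (hinvt.const_mul (F (z 0) (z 1 - T (z 0))))
  have hfun : (fun s => ishPullback lam T F Ξ Ξx s z) =
      fun s => vec2 (Ξ s (ishAbscissa lam T z)) (F (z 0) (z 1 - T (z 0)) * (Ξx s (ishAbscissa lam T z))⁻¹) := by
    funext s; rw [ishPullback_apply, div_eq_mul_inv]
  rw [hfun]
  exact h

/-- **Space derivative of the pullback**: with `ξ₀ = ξ(z)`, `s = z₁ - T(z₀)`, `a = 1 + λ' s - λ Tₓ`,
`b = λ` (profile data at `z₀`), `F, Fₓ, Fₛ` at `(z₀, s)` and `Ξₓ, Ξₓₓ` at `(t, ξ₀)`,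
`D_zΨ(t,z)[v] = (Ξₓ (a v₀ + b v₁), ((Fₓ - TₓFₛ)/Ξₓ - F Ξₓₓ a/Ξₓ²) v₀ + (Fₛ/Ξₓ - F Ξₓₓ b/Ξₓ²) v₁)`.
[folklore] -/
theorem hasFDerivAt_ishPullback {lam lamx T Tx : ℝ → ℝ} {F Fu Fs : ℝ → ℝ → ℝ} {Ξ Ξx Ξxx : ℝ → ℝ → ℝ}
    {t : ℝ} {z : E²} (hlam : HasDerivAt lam (lamx (z 0)) (z 0)) (hTx : HasDerivAt T (Tx (z 0)) (z 0))
    (hF : HasFDerivAt (uncurry F)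
      (Fu (z 0) (z 1 - T (z 0)) • ContinuousLinearMap.fst ℝ ℝ ℝ +
        Fs (z 0) (z 1 - T (z 0)) • ContinuousLinearMap.snd ℝ ℝ ℝ) (z 0, z 1 - T (z 0)))
    (hx : HasDerivAt (Ξ t) (Ξx t (ishAbscissa lam T z)) (ishAbscissa lam T z))
    (hxx : HasDerivAt (Ξx t) (Ξxx t (ishAbscissa lam T z)) (ishAbscissa lam T z))
    (hne : Ξx t (ishAbscissa lam T z) ≠ 0) :
    HasFDerivAt (ishPullback lam T F Ξ Ξx t)
      (((Ξx t (ishAbscissa lam T z) * (1 + lamx (z 0) * (z 1 - T (z 0)) - lam (z 0) * Tx (z 0))) •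
            (EuclideanSpace.proj (0 : Fin 2) : E² →L[ℝ] ℝ) +
          (Ξx t (ishAbscissa lam T z) * lam (z 0)) • (EuclideanSpace.proj (1 : Fin 2) : E² →L[ℝ] ℝ)).smulRight
          (EuclideanSpace.single 0 1) +
        (((Fu (z 0) (z 1 - T (z 0)) - Tx (z 0) * Fs (z 0) (z 1 - T (z 0))) * (Ξx t (ishAbscissa lam T z))⁻¹ +
              F (z 0) (z 1 - T (z 0)) * (-Ξxx t (ishAbscissa lam T z) / Ξx t (ishAbscissa lam T z) ^ 2 *
                (1 + lamx (z 0) * (z 1 - T (z 0)) - lam (z 0) * Tx (z 0)))) •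
              (EuclideanSpace.proj (0 : Fin 2) : E² →L[ℝ] ℝ) +
            (Fs (z 0) (z 1 - T (z 0)) * (Ξx t (ishAbscissa lam T z))⁻¹ +
              F (z 0) (z 1 - T (z 0)) * (-Ξxx t (ishAbscissa lam T z) / Ξx t (ishAbscissa lam T z) ^ 2 * lam (z 0))) •
              (EuclideanSpace.proj (1 : Fin 2) : E² →L[ℝ] ℝ)).smulRight
          (EuclideanSpace.single 1 1)) z := by
  set ξ₀ := ishAbscissa lam T z with hξ₀
  set P0 := (EuclideanSpace.proj (0 : Fin 2) : E² →L[ℝ] ℝ)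
  set P1 := (EuclideanSpace.proj (1 : Fin 2) : E² →L[ℝ] ℝ)
  set a := 1 + lamx (z 0) * (z 1 - T (z 0)) - lam (z 0) * Tx (z 0) with ha
  have hξ : HasFDerivAt (ishAbscissa lam T) (a • P0 + lam (z 0) • P1) z := hasFDerivAt_ishAbscissa hlam hTx
  -- first component `Ξ t (ξ w)`
  have hP : HasFDerivAt (fun w : E² => Ξ t (ishAbscissa lam T w))
      ((Ξx t ξ₀ * a) • P0 + (Ξx t ξ₀ * lam (z 0)) • P1) z := by
    refine (hx.comp_hasFDerivAt z hξ).congr_fderiv ?_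
    ext v
    simp only [_root_.add_apply, _root_.smul_apply, smul_eq_mul]
    ring
  -- the inverse slope `(Ξx t (ξ w))⁻¹`
  have hI : HasFDerivAt (fun w : E² => (Ξx t (ishAbscissa lam T w))⁻¹)
      ((-Ξxx t ξ₀ / Ξx t ξ₀ ^ 2 * a) • P0 + (-Ξxx t ξ₀ / Ξx t ξ₀ ^ 2 * lam (z 0)) • P1) z := by
    have hinv : HasDerivAt (fun r => (Ξx t r)⁻¹) (-Ξxx t ξ₀ / Ξx t ξ₀ ^ 2) ξ₀ := hxx.fun_inv hne
    refine (hinv.comp_hasFDerivAt z hξ).congr_fderiv ?_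
    ext v
    simp only [_root_.add_apply, _root_.smul_apply, smul_eq_mul]
    ring
  -- the compensated coordinate
  have hFw := hasFDerivAt_compF hTx hF
  have hQ : HasFDerivAt (fun w : E² => F (w 0) (w 1 - T (w 0)) * (Ξx t (ishAbscissa lam T w))⁻¹)
      (((Fu (z 0) (z 1 - T (z 0)) - Tx (z 0) * Fs (z 0) (z 1 - T (z 0))) * (Ξx t ξ₀)⁻¹ +
            F (z 0) (z 1 - T (z 0)) * (-Ξxx t ξ₀ / Ξx t ξ₀ ^ 2 * a)) • P0 +
        (Fs (z 0) (z 1 - T (z 0)) * (Ξx t ξ₀)⁻¹ +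
            F (z 0) (z 1 - T (z 0)) * (-Ξxx t ξ₀ / Ξx t ξ₀ ^ 2 * lam (z 0))) • P1) z := by
    refine (hFw.mul hI).congr_fderiv ?_
    ext v
    simp only [_root_.add_apply, _root_.smul_apply, smul_eq_mul, hξ₀]
    ring
  have hfun : ishPullback lam T F Ξ Ξx t =
      fun w => vec2 (Ξ t (ishAbscissa lam T w)) (F (w 0) (w 1 - T (w 0)) * (Ξx t (ishAbscissa lam T w))⁻¹) := by
    funext w; rw [ishPullback_apply, div_eq_mul_inv]
  rw [hfun]
  exact hasFDerivAt_vec2 hP hQ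

/-! ## Pullback identity and transport -/

/-- **Pullback identity of the interpolated-shear band**: at a point where `F` solves (★),
`(1 + λ' s) Fₛ - λ Fₓ = 1`, and `Ξₓ(t, ξ) ≠ 0`, the pair (`ishPullback`, `ishVelocity` of the rate
`g = -Ξₜ/Ξₓ`, its `x`-derivative, and the data) satisfies `∂ₜΨ + D_zΨ[V] = 0`: the Jacobian of
`Ψ(t,·)` is `1` and `V = -(D_zΨ)⁻¹ ∂ₜΨ`. [folklore] -/
theorem ish_pullback_identity {lam lamx T Tx : ℝ → ℝ} {F Fu Fs : ℝ → ℝ → ℝ} {Ξ Ξx Ξt Ξxx Ξxt : ℝ → ℝ → ℝ}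
    {t : ℝ} {z : E²} (hlam : HasDerivAt lam (lamx (z 0)) (z 0)) (hTx : HasDerivAt T (Tx (z 0)) (z 0))
    (hF : HasFDerivAt (uncurry F)
      (Fu (z 0) (z 1 - T (z 0)) • ContinuousLinearMap.fst ℝ ℝ ℝ +
        Fs (z 0) (z 1 - T (z 0)) • ContinuousLinearMap.snd ℝ ℝ ℝ) (z 0, z 1 - T (z 0)))
    (hpde : (1 + lamx (z 0) * (z 1 - T (z 0))) * Fs (z 0) (z 1 - T (z 0)) -
      lam (z 0) * Fu (z 0) (z 1 - T (z 0)) = 1)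
    (ht : HasDerivAt (fun s => Ξ s (ishAbscissa lam T z)) (Ξt t (ishAbscissa lam T z)) t)
    (hx : HasDerivAt (Ξ t) (Ξx t (ishAbscissa lam T z)) (ishAbscissa lam T z))
    (hxx : HasDerivAt (Ξx t) (Ξxx t (ishAbscissa lam T z)) (ishAbscissa lam T z))
    (hxt : HasDerivAt (fun s => Ξx s (ishAbscissa lam T z)) (Ξxt t (ishAbscissa lam T z)) t)
    (hne : Ξx t (ishAbscissa lam T z) ≠ 0) :
    deriv (fun s => ishPullback lam T F Ξ Ξx s z) t +
      fderiv ℝ (ishPullback lam T F Ξ Ξx t) z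
        (ishVelocity lam lamx T Tx F Fu Fs (axialRate Ξx Ξt) (axialRateDeriv Ξx Ξt Ξxx Ξxt) t z) = 0 := by
  set X := Ξx t (ishAbscissa lam T z) with hX
  set S := Ξt t (ishAbscissa lam T z) with hS
  set XX := Ξxx t (ishAbscissa lam T z) with hXX
  set XT := Ξxt t (ishAbscissa lam T z) with hXT
  set F₀ := F (z 0) (z 1 - T (z 0)) with hF₀
  set Fu₀ := Fu (z 0) (z 1 - T (z 0)) with hFu₀
  set Fs₀ := Fs (z 0) (z 1 - T (z 0)) with hFs₀
  set L := lam (z 0) with hL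
  set Lx := lamx (z 0) with hLx
  set A := T (z 0) with hA
  set Ax := Tx (z 0) with hAx
  have hV : ishVelocity lam lamx T Tx F Fu Fs (axialRate Ξx Ξt) (axialRateDeriv Ξx Ξt Ξxx Ξxt) t z =
      vec2 (-S / X * Fs₀ + L * F₀ * (-(XT * X - S * XX) / X ^ 2))
        (-(-S / X * (Fu₀ - Ax * Fs₀)) - (1 + Lx * (z 1 - A) - L * Ax) * F₀ * (-(XT * X - S * XX) / X ^ 2)) := rfl
  rw [(hasDerivAt_ishPullback ht hxt hne).deriv, (hasFDerivAt_ishPullback hlam hTx hF hx hxx hne).fderiv, hV]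
  simp only [_root_.add_apply, ContinuousLinearMap.smulRight_apply, _root_.smul_apply, smul_eq_mul,
    show ∀ a b : ℝ, (EuclideanSpace.proj (0 : Fin 2) : E² →L[ℝ] ℝ) (vec2 a b) = a from
      fun a b => vec2_apply_zero a b,
    show ∀ a b : ℝ, (EuclideanSpace.proj (1 : Fin 2) : E² →L[ℝ] ℝ) (vec2 a b) = b from
      fun a b => vec2_apply_one a b]
  rw [show ∀ a b : ℝ, a • (EuclideanSpace.single 0 1 : E²) + b • (EuclideanSpace.single 1 1 : E²) =
      vec2 a b from fun a b => rfl]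
  rw [vec2_add_vec2, vec2_eq_zero_iff, ← hX, ← hXX, ← hXT, ← hS, ← hF₀, ← hFu₀, ← hFs₀, ← hL, ← hLx, ← hA, ← hAx]
  constructor
  · field_simp
    linear_combination (-(S * X)) * hpde
  · field_simp
    linear_combination (F₀ * X ^ 2 * XT) * hpde

/-- **Transport by the interpolated-shear band**: for every profile `Θ_ref` differentiable at
`Ψ(t,z)`, `Θ_ref ∘ Ψ` is transported at `(t,z)` by the velocity. [folklore] -/
theorem transport_comp_ishPullback {Θ : E² → G} {lam lamx T Tx : ℝ → ℝ} {F Fu Fs : ℝ → ℝ → ℝ}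
    {Ξ Ξx Ξt Ξxx Ξxt : ℝ → ℝ → ℝ} {t : ℝ} {z : E²}
    (hΘ : DifferentiableAt ℝ Θ (ishPullback lam T F Ξ Ξx t z))
    (hlam : HasDerivAt lam (lamx (z 0)) (z 0)) (hTx : HasDerivAt T (Tx (z 0)) (z 0))
    (hF : HasFDerivAt (uncurry F)
      (Fu (z 0) (z 1 - T (z 0)) • ContinuousLinearMap.fst ℝ ℝ ℝ +
        Fs (z 0) (z 1 - T (z 0)) • ContinuousLinearMap.snd ℝ ℝ ℝ) (z 0, z 1 - T (z 0)))
    (hpde : (1 + lamx (z 0) * (z 1 - T (z 0))) * Fs (z 0) (z 1 - T (z 0)) -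
      lam (z 0) * Fu (z 0) (z 1 - T (z 0)) = 1)
    (ht : HasDerivAt (fun s => Ξ s (ishAbscissa lam T z)) (Ξt t (ishAbscissa lam T z)) t)
    (hx : HasDerivAt (Ξ t) (Ξx t (ishAbscissa lam T z)) (ishAbscissa lam T z))
    (hxx : HasDerivAt (Ξx t) (Ξxx t (ishAbscissa lam T z)) (ishAbscissa lam T z))
    (hxt : HasDerivAt (fun s => Ξx s (ishAbscissa lam T z)) (Ξxt t (ishAbscissa lam T z)) t)
    (hne : Ξx t (ishAbscissa lam T z) ≠ 0) :
    deriv (fun s => Θ (ishPullback lam T F Ξ Ξx s z)) t +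
      fderiv ℝ (fun w => Θ (ishPullback lam T F Ξ Ξx t w)) z
        (ishVelocity lam lamx T Tx F Fu Fs (axialRate Ξx Ξt) (axialRateDeriv Ξx Ξt Ξxx Ξxt) t z) = 0 :=
  transport_comp_of_pullback hΘ (hasDerivAt_ishPullback ht hxt hne).differentiableAt
    (hasFDerivAt_ishPullback hlam hTx hF hx hxx hne).differentiableAt
    (ish_pullback_identity hlam hTx hF hpde ht hx hxx hxt hne)

/-! ## The stream function: `V = ∇⊥H` -/

/-- **Derivative of the stream function** `H = g(t, ξ) F(x, s)`:
`D_zH[v] = (gₓ a F + g (Fₓ - Tₓ Fₛ)) v₀ + (gₓ λ F + g Fₛ) v₁`, `a = 1 + λ' s - λ Tₓ`. [folklore] -/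
theorem hasFDerivAt_ishStream {lam lamx T Tx : ℝ → ℝ} {F Fu Fs : ℝ → ℝ → ℝ} {g gx : ℝ → ℝ → ℝ} {t : ℝ}
    {z : E²} (hg : HasDerivAt (g t) (gx t (ishAbscissa lam T z)) (ishAbscissa lam T z))
    (hlam : HasDerivAt lam (lamx (z 0)) (z 0)) (hTx : HasDerivAt T (Tx (z 0)) (z 0))
    (hF : HasFDerivAt (uncurry F)
      (Fu (z 0) (z 1 - T (z 0)) • ContinuousLinearMap.fst ℝ ℝ ℝ +
        Fs (z 0) (z 1 - T (z 0)) • ContinuousLinearMap.snd ℝ ℝ ℝ) (z 0, z 1 - T (z 0))) :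
    HasFDerivAt (ishStream lam T F g t)
      ((gx t (ishAbscissa lam T z) * (1 + lamx (z 0) * (z 1 - T (z 0)) - lam (z 0) * Tx (z 0)) *
              F (z 0) (z 1 - T (z 0)) +
            g t (ishAbscissa lam T z) * (Fu (z 0) (z 1 - T (z 0)) - Tx (z 0) * Fs (z 0) (z 1 - T (z 0)))) •
          (EuclideanSpace.proj (0 : Fin 2) : E² →L[ℝ] ℝ) +
        (gx t (ishAbscissa lam T z) * lam (z 0) * F (z 0) (z 1 - T (z 0)) +
            g t (ishAbscissa lam T z) * Fs (z 0) (z 1 - T (z 0))) •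
          (EuclideanSpace.proj (1 : Fin 2) : E² →L[ℝ] ℝ)) z := by
  set ξ₀ := ishAbscissa lam T z with hξ₀
  set P0 := (EuclideanSpace.proj (0 : Fin 2) : E² →L[ℝ] ℝ)
  set P1 := (EuclideanSpace.proj (1 : Fin 2) : E² →L[ℝ] ℝ)
  set a := 1 + lamx (z 0) * (z 1 - T (z 0)) - lam (z 0) * Tx (z 0) with ha
  have hξ : HasFDerivAt (ishAbscissa lam T) (a • P0 + lam (z 0) • P1) z := hasFDerivAt_ishAbscissa hlam hTx
  have hG : HasFDerivAt (fun w : E² => g t (ishAbscissa lam T w)) ((gx t ξ₀ * a) • P0 + (gx t ξ₀ * lam (z 0)) • P1) z := by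
    refine (hg.comp_hasFDerivAt z hξ).congr_fderiv ?_
    ext v
    simp only [_root_.add_apply, _root_.smul_apply, smul_eq_mul]
    ring
  have hFw := hasFDerivAt_compF hTx hF
  have hfun : ishStream lam T F g t = fun w => g t (ishAbscissa lam T w) * F (w 0) (w 1 - T (w 0)) := by
    funext w; rfl
  rw [hfun]
  refine (hG.mul hFw).congr_fderiv ?_
  ext v
  simp only [_root_.add_apply, _root_.smul_apply, smul_eq_mul, hξ₀]
  ring

/-- **The velocity is the perpendicular gradient of the stream function**: `V = (∂_yH, -∂ₓH)`.
[folklore] -/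
theorem ishVelocity_eq_perpGrad_ishStream {lam lamx T Tx : ℝ → ℝ} {F Fu Fs : ℝ → ℝ → ℝ} {g gx : ℝ → ℝ → ℝ}
    {t : ℝ} {z : E²} (hg : HasDerivAt (g t) (gx t (ishAbscissa lam T z)) (ishAbscissa lam T z))
    (hlam : HasDerivAt lam (lamx (z 0)) (z 0)) (hTx : HasDerivAt T (Tx (z 0)) (z 0))
    (hF : HasFDerivAt (uncurry F)
      (Fu (z 0) (z 1 - T (z 0)) • ContinuousLinearMap.fst ℝ ℝ ℝ +
        Fs (z 0) (z 1 - T (z 0)) • ContinuousLinearMap.snd ℝ ℝ ℝ) (z 0, z 1 - T (z 0))) :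
    ishVelocity lam lamx T Tx F Fu Fs g gx t z = perpGrad (ishStream lam T F g t) z := by
  rw [perpGrad_apply, (hasFDerivAt_ishStream hg hlam hTx hF).fderiv, ishVelocity_apply, vec2_eq_vec2_iff]
  simp only [_root_.add_apply, _root_.smul_apply, smul_eq_mul, PiLp.proj_apply, PiLp.single_apply]
  refine ⟨?_, ?_⟩
  · simp only [Fin.isValue, if_false, if_true, mul_zero, mul_one, zero_add, zero_ne_one]
    ring
  · simp only [Fin.isValue, one_ne_zero, if_false, if_true, mul_zero, mul_one, add_zero]
    ring

/-- **The velocity is divergence free** wherever it is the perpendicular gradient of a `C²` stream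
function near the point (both hold for smooth data, `ishVelocity_eq_perpGrad_ishStream`). [folklore] -/
theorem divergence_ishVelocity {lam lamx T Tx : ℝ → ℝ} {F Fu Fs : ℝ → ℝ → ℝ} {g gx : ℝ → ℝ → ℝ} {t : ℝ}
    {z : E²} (hH : ContDiffAt ℝ 2 (ishStream lam T F g t) z)
    (heq : ishVelocity lam lamx T Tx F Fu Fs g gx t =ᶠ[𝓝 z] perpGrad (ishStream lam T F g t)) :
    ∑ j, fderiv ℝ (ishVelocity lam lamx T Tx F Fu Fs g gx t) z (EuclideanSpace.single j 1) j = 0 := by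
  have h : ∀ j, fderiv ℝ (ishVelocity lam lamx T Tx F Fu Fs g gx t) z (EuclideanSpace.single j 1) j =
      fderiv ℝ (perpGrad (ishStream lam T F g t)) z (EuclideanSpace.single j 1) j := fun j => by
    rw [heq.fderiv_eq]
  simp only [h]
  exact divergence_perpGrad hH

/-- **A static band at rest has zero velocity**: `g(t,·) = 0`, `gₓ(t,·) = 0` at the abscissa.
[folklore] -/
theorem ishVelocity_eq_zero {lam lamx T Tx : ℝ → ℝ} {F Fu Fs : ℝ → ℝ → ℝ} {g gx : ℝ → ℝ → ℝ} {t : ℝ}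
    {w : E²} (hg : g t (ishAbscissa lam T w) = 0) (hgx : gx t (ishAbscissa lam T w) = 0) :
    ishVelocity lam lamx T Tx F Fu Fs g gx t w = 0 := by
  rw [ishVelocity_apply, hg, hgx, vec2_eq_zero_iff]
  constructor <;> ring

/-! ## Smoothness -/

section Smoothness

variable {n : WithTop ℕ∞}

/-- The abscissa is smooth in `(t, z)` (it does not depend on `t`). [folklore] -/
theorem contDiff_ishAbscissa_snd {lam T : ℝ → ℝ} (hlam : ContDiff ℝ n lam) (hT : ContDiff ℝ n T) :
    ContDiff ℝ n fun p : ℝ × E² => ishAbscissa lam T p.2 := by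
  have h0 : ContDiff ℝ n fun p : ℝ × E² => p.2 0 := (contDiff_coord 0).comp contDiff_snd
  have h1 : ContDiff ℝ n fun p : ℝ × E² => p.2 1 := (contDiff_coord 1).comp contDiff_snd
  simp only [ishAbscissa_apply]
  exact h0.add ((hlam.comp h0).mul (h1.sub (hT.comp h0)))

/-- The compensated coordinate `(t, w) ↦ F(w₀, w₁ - T(w₀))` is smooth when `F`, `T` are. [folklore] -/
theorem contDiff_compF_snd {T : ℝ → ℝ} {F : ℝ → ℝ → ℝ} (hT : ContDiff ℝ n T) (hF : ContDiff ℝ n (uncurry F)) :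
    ContDiff ℝ n fun p : ℝ × E² => F (p.2 0) (p.2 1 - T (p.2 0)) := by
  have h0 : ContDiff ℝ n fun p : ℝ × E² => p.2 0 := (contDiff_coord 0).comp contDiff_snd
  have h1 : ContDiff ℝ n fun p : ℝ × E² => p.2 1 := (contDiff_coord 1).comp contDiff_snd
  exact hF.comp (h0.prodMk (h1.sub (hT.comp h0)))

/-- **The pullback is smooth** when `λ, T, F, Ξ` and the (nowhere vanishing) datum `Ξₓ` are.
[folklore] -/
theorem contDiff_uncurry_ishPullback {lam T : ℝ → ℝ} {F : ℝ → ℝ → ℝ} {Ξ Ξx : ℝ → ℝ → ℝ}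
    (hlam : ContDiff ℝ n lam) (hT : ContDiff ℝ n T) (hF : ContDiff ℝ n (uncurry F))
    (hΞ : ContDiff ℝ n (uncurry Ξ)) (hΞx : ContDiff ℝ n (uncurry Ξx)) (hne : ∀ t x, Ξx t x ≠ 0) :
    ContDiff ℝ n (uncurry (ishPullback lam T F Ξ Ξx)) := by
  have hξ : ContDiff ℝ n fun p : ℝ × E² => ((p.1, ishAbscissa lam T p.2) : ℝ × ℝ) :=
    contDiff_fst.prodMk (contDiff_ishAbscissa_snd hlam hT)
  have h1 : ContDiff ℝ n fun p : ℝ × E² => uncurry Ξ (p.1, ishAbscissa lam T p.2) := hΞ.comp hξ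
  have h2 : ContDiff ℝ n fun p : ℝ × E² =>
      F (p.2 0) (p.2 1 - T (p.2 0)) / uncurry Ξx (p.1, ishAbscissa lam T p.2) :=
    (contDiff_compF_snd hT hF).div (hΞx.comp hξ) fun p => hne p.1 _
  exact contDiff_vec2 h1 h2

/-- **The stream function is smooth** when `λ, T, F, g` are. [folklore] -/
theorem contDiff_uncurry_ishStream {lam T : ℝ → ℝ} {F : ℝ → ℝ → ℝ} {g : ℝ → ℝ → ℝ}
    (hlam : ContDiff ℝ n lam) (hT : ContDiff ℝ n T) (hF : ContDiff ℝ n (uncurry F))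
    (hg : ContDiff ℝ n (uncurry g)) : ContDiff ℝ n (uncurry (ishStream lam T F g)) := by
  have hξ : ContDiff ℝ n fun p : ℝ × E² => ((p.1, ishAbscissa lam T p.2) : ℝ × ℝ) :=
    contDiff_fst.prodMk (contDiff_ishAbscissa_snd hlam hT)
  exact (hg.comp hξ).mul (contDiff_compF_snd hT hF)

/-- **The velocity is smooth** when all its data are. [folklore] -/
theorem contDiff_uncurry_ishVelocity {lam lamx T Tx : ℝ → ℝ} {F Fu Fs : ℝ → ℝ → ℝ} {g gx : ℝ → ℝ → ℝ}
    (hlam : ContDiff ℝ n lam) (hlamx : ContDiff ℝ n lamx) (hT : ContDiff ℝ n T) (hTx : ContDiff ℝ n Tx)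
    (hF : ContDiff ℝ n (uncurry F)) (hFu : ContDiff ℝ n (uncurry Fu)) (hFs : ContDiff ℝ n (uncurry Fs))
    (hg : ContDiff ℝ n (uncurry g)) (hgx : ContDiff ℝ n (uncurry gx)) :
    ContDiff ℝ n (uncurry (ishVelocity lam lamx T Tx F Fu Fs g gx)) := by
  have hξ : ContDiff ℝ n fun p : ℝ × E² => ((p.1, ishAbscissa lam T p.2) : ℝ × ℝ) :=
    contDiff_fst.prodMk (contDiff_ishAbscissa_snd hlam hT)
  have h0 : ContDiff ℝ n fun p : ℝ × E² => p.2 0 := (contDiff_coord 0).comp contDiff_snd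
  have hs : ContDiff ℝ n fun p : ℝ × E² => p.2 1 - T (p.2 0) :=
    ((contDiff_coord 1).comp contDiff_snd).sub (hT.comp h0)
  have hFc := contDiff_compF_snd (n := n) hT hF
  have hFuc := contDiff_compF_snd (n := n) hT hFu
  have hFsc := contDiff_compF_snd (n := n) hT hFs
  have h1 : ContDiff ℝ n fun p : ℝ × E² =>
      uncurry g (p.1, ishAbscissa lam T p.2) * Fs (p.2 0) (p.2 1 - T (p.2 0)) +
        lam (p.2 0) * F (p.2 0) (p.2 1 - T (p.2 0)) * uncurry gx (p.1, ishAbscissa lam T p.2) :=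
    ((hg.comp hξ).mul hFsc).add (((hlam.comp h0).mul hFc).mul (hgx.comp hξ))
  have h2 : ContDiff ℝ n fun p : ℝ × E² =>
      -(uncurry g (p.1, ishAbscissa lam T p.2) *
          (Fu (p.2 0) (p.2 1 - T (p.2 0)) - Tx (p.2 0) * Fs (p.2 0) (p.2 1 - T (p.2 0)))) -
        (1 + lamx (p.2 0) * (p.2 1 - T (p.2 0)) - lam (p.2 0) * Tx (p.2 0)) * F (p.2 0) (p.2 1 - T (p.2 0)) *
          uncurry gx (p.1, ishAbscissa lam T p.2) :=
    ((hg.comp hξ).mul (hFuc.sub ((hTx.comp h0).mul hFsc))).neg.sub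
      ((((contDiff_const.add ((hlamx.comp h0).mul hs)).sub ((hlam.comp h0).mul (hTx.comp h0))).mul hFc).mul
        (hgx.comp hξ))
  exact contDiff_vec2 h1 h2

/-- **A profile moved by the pullback is smooth.** [folklore] -/
theorem contDiff_uncurry_comp_ishPullback {Θ : E² → G} {lam T : ℝ → ℝ} {F : ℝ → ℝ → ℝ} {Ξ Ξx : ℝ → ℝ → ℝ}
    (hΘ : ContDiff ℝ n Θ) (hlam : ContDiff ℝ n lam) (hT : ContDiff ℝ n T) (hF : ContDiff ℝ n (uncurry F))
    (hΞ : ContDiff ℝ n (uncurry Ξ)) (hΞx : ContDiff ℝ n (uncurry Ξx)) (hne : ∀ t x, Ξx t x ≠ 0) :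
    ContDiff ℝ n (uncurry fun t z => Θ (ishPullback lam T F Ξ Ξx t z)) :=
  contDiff_uncurry_comp hΘ (contDiff_uncurry_ishPullback hlam hT hF hΞ hΞx hne)

end Smoothness

end PlanarKinematics

end Literature.Analysis.FluidPDE
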